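import Summits.QuantumFields.YangMills.Theorems.ForcedResponseSkewnessRunningCouplingCeilingSmearToolkit
import Literature.MathematicalPhysics.QuantumLattice.MeshUniformLatticeSums
import HarnessLib

/-!
# Crux `ResponseLocalisation` (repaired item stmt-QuantumFields-24293, successor of 23615), route
# `ForcedResponseSkewness`: lattice toolkit for the FAR-FIELD half of localisation

Support file (`--supports`, helper) of the width prover `ym-line-frs-p2` on the localisation crux (lead
`ym-line-frs-p1`).  Elementary lattice analysis on `ℤ⁴ ⊂ ℝ⁴ = EuclideanSpace ℝ (Fin 4)` used by the far-field
smearing theorem (`…ResponseLocalisationFarSmear.lean`): the far part of the response profile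
`respM(x) = Σ_{y,z} θv(s y) v(s z) torusK3(x,y,z)` is summable beyond a physical radius `D`, uniformly in
the spacing `s ≤ 1` and in the torus, once the third cumulant obeys a scale-free triangle majorant.

* `sum_Ico_weight_le` — the telescoping TAIL bound `Σ_{N ≤ i < K} a/(1 + a i)² ≤ 1/(1 + a(N−1))` (`1 ≤ N`);
* `sum_filter_weight_int_le` — integers beyond a physical threshold: `Σ_{j ∈ T, M ≤ s|j|} s/(1 + s|j|)² ≤ 2/M`
  for `0 < s ≤ 1 ≤ M`;
* `sum_box_far_bracket_le` — the FAR mesh-uniform Riemann bound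
  `s⁴ · Σ_{x ∈ box L, D < ‖s x‖} (1 + ‖s x‖)^{-8} ≤ 1024/D` (`0 < s ≤ 1`, `2 ≤ D`), by covering the far region
  with the four coordinate slabs `{D/2 < s|x_μ|}` and the product trick of `MeshUniformLatticeSums`;
* `abs_sub_abs_le_abs_valMinAbs`, `norm_sub_norm_le_torusDist` — torus geometry on the box: the torus
  distance from a box site `x` to any site `y` dominates the difference of their Euclidean norms,
  `‖x‖ − ‖y‖ ≤ torusDist L x y` (no wrap-around can bring a far site close to a site near the origin).

Honest label: bookkeeping for a CONDITIONAL rung line (leaf R2a `BalabanLadder.NT`); nothing here bears on the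
Yang–Mills mass gap, which is NOT proved by any of this.  Refs: Glimm–Jaffe, Quantum Physics (1987) §9.5 (lattice
Riemann sums); the tree's `MeshUniformLatticeSums`.
-/

set_option autoImplicit false

noncomputable section

namespace Summit.QuantumFields.YangMills.Cruxes.ResponseLocalisation.Far

open Set Metric Filter Topology Finset
open scoped SchwartzMap
open Literature.MathematicalPhysics.QuantumLattice Literature.Probability.LatticeModels
open Summit.QuantumFields.YangMills.Cruxes.RunningCouplingCeiling.Pointwise

/-! ### One-dimensional tails -/

/-- One telescoping step: `a/(1 + a(i+1))² ≤ 1/(1 + a i) − 1/(1 + a(i+1))` for `0 ≤ a`. [folklore] -/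
theorem weight_le_sub (a : ℝ) (ha : 0 ≤ a) (i : ℕ) :
    a / (1 + a * ((i : ℝ) + 1)) ^ 2 ≤ 1 / (1 + a * i) - 1 / (1 + a * ((i : ℝ) + 1)) := by
  have h0 : 0 < 1 + a * (i : ℝ) := by positivity
  have h1 : 0 < 1 + a * ((i : ℝ) + 1) := by positivity
  rw [div_sub_div _ _ h0.ne' h1.ne', div_le_div_iff₀ (by positivity) (by positivity)]
  have : 1 * (1 + a * ((i : ℝ) + 1)) - (1 + a * i) * 1 = a := by ring
  rw [this]
  have hle : (1 + a * (i : ℝ)) ≤ 1 + a * ((i : ℝ) + 1) := by nlinarith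
  calc a * ((1 + a * ↑i) * (1 + a * (↑i + 1)))
      ≤ a * ((1 + a * (↑i + 1)) * (1 + a * (↑i + 1))) := by gcongr
    _ = a * (1 + a * (↑i + 1)) ^ 2 := by ring

/-- **Telescoping tail bound**: `Σ_{N ≤ i < K} a/(1 + a i)² ≤ 1/(1 + a(N−1))` for `0 ≤ a`, `1 ≤ N`. [folklore] -/
theorem sum_Ico_weight_le (a : ℝ) (ha : 0 ≤ a) {N : ℕ} (hN : 1 ≤ N) (K : ℕ) :
    ∑ i ∈ Finset.Ico N K, a / (1 + a * (i : ℝ)) ^ 2 ≤ 1 / (1 + a * ((N : ℝ) - 1)) := by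
  -- with the telescoped remainder
  have key : ∀ K : ℕ, N ≤ K →
      ∑ i ∈ Finset.Ico N K, a / (1 + a * (i : ℝ)) ^ 2 ≤
        1 / (1 + a * ((N : ℝ) - 1)) - 1 / (1 + a * ((K : ℝ) - 1)) := by
    intro K hK
    induction K, hK using Nat.le_induction with
    | base => simp
    | succ K hK ih =>
      rw [Finset.sum_Ico_succ_top hK]
      obtain ⟨j, rfl⟩ : ∃ j : ℕ, K = j + 1 := ⟨K - 1, by omega⟩
      have hstep := weight_le_sub a ha j
      push_cast at ih hstep ⊢
      simp only [add_sub_cancel_right] at ih ⊢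
      linarith
  by_cases hK : N ≤ K
  · have h := key K hK
    have : 0 ≤ 1 / (1 + a * ((K : ℝ) - 1)) := by
      have : (1 : ℝ) ≤ K := by exact_mod_cast le_trans hN hK
      positivity
    linarith
  · rw [Finset.Ico_eq_empty (by omega), Finset.sum_empty]
    have : (1 : ℝ) ≤ N := by exact_mod_cast hN
    positivity

/-- **Integers beyond a physical threshold**: `Σ_{j ∈ T, M ≤ s|j|} s/(1 + s|j|)² ≤ 2/M` for `0 < s ≤ 1 ≤ M`
(the map `j ↦ |j|` is at most two-to-one into `{i : ℕ | ⌈M/s⌉ ≤ i}`, then `sum_Ico_weight_le`). [folklore] -/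
theorem sum_filter_weight_int_le {s : ℝ} (hs : 0 < s) (hs1 : s ≤ 1) {M : ℝ} (hM : 1 ≤ M)
    (T : Finset ℤ) :
    ∑ j ∈ T.filter (fun j : ℤ => M ≤ s * |(j : ℝ)|), s / (1 + s * |(j : ℝ)|) ^ 2 ≤ 2 / M := by
  set f : ℕ → ℝ := fun i => s / (1 + s * (i : ℝ)) ^ 2 with hf
  have hf0 : ∀ i, 0 ≤ f i := fun i => by positivity
  set T' := T.filter (fun j : ℤ => M ≤ s * |(j : ℝ)|) with hT'
  have hterm : ∀ j : ℤ, s / (1 + s * |(j : ℝ)|) ^ 2 = f j.natAbs := by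
    intro j
    simp only [hf, Nat.cast_natAbs, Int.cast_abs]
  simp_rw [hterm]
  rw [sum_comp]
  -- the threshold in `ℕ`
  set N : ℕ := ⌈M / s⌉₊ with hN
  have hN1 : 1 ≤ N := by
    rw [hN, Nat.one_le_ceil_iff]
    exact div_pos (by linarith) hs
  have hNle : ∀ j ∈ T', N ≤ j.natAbs := by
    intro j hj
    rw [hT', mem_filter] at hj
    have h1 : M / s ≤ |(j : ℝ)| := by
      rw [div_le_iff₀ hs]; linarith [hj.2]
    have h2 : (|(j : ℝ)|) = (j.natAbs : ℝ) := by
      rw [Nat.cast_natAbs, Int.cast_abs]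
    rw [h2] at h1
    exact Nat.ceil_le.mpr h1
  set K := T'.sup Int.natAbs with hK
  have hcard : ∀ i ∈ T'.image Int.natAbs, (#{j ∈ T' | j.natAbs = i} : ℝ) • f i ≤ (2 : ℝ) * f i := by
    intro i _
    rw [smul_eq_mul]
    refine mul_le_mul_of_nonneg_right ?_ (hf0 i)
    have hsub : {j ∈ T' | j.natAbs = i} ⊆ ({(i : ℤ), -(i : ℤ)} : Finset ℤ) := by
      intro j hj
      rw [mem_filter] at hj
      rcases Int.natAbs_eq_iff.mp hj.2 with h | h <;> simp [h]
    have := (Finset.card_le_card hsub).trans Finset.card_le_two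
    exact_mod_cast this
  have himg : T'.image Int.natAbs ⊆ Finset.Ico N (K + 1) := by
    intro i hi
    obtain ⟨j, hj, rfl⟩ := mem_image.mp hi
    exact Finset.mem_Ico.mpr ⟨hNle j hj, Nat.lt_succ_of_le (le_sup (f := Int.natAbs) hj)⟩
  have htail := sum_Ico_weight_le s hs.le hN1 (K + 1)
  have hden : M ≤ 1 + s * ((N : ℝ) - 1) := by
    have h1 : M / s ≤ N := by rw [hN]; exact Nat.le_ceil _
    have h2 : M ≤ s * N := by rwa [div_le_iff₀' hs] at h1
    nlinarith
  calc ∑ i ∈ T'.image Int.natAbs, #{j ∈ T' | j.natAbs = i} • f i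
      = ∑ i ∈ T'.image Int.natAbs, (#{j ∈ T' | j.natAbs = i} : ℝ) • f i := by
        simp [nsmul_eq_mul]
    _ ≤ ∑ i ∈ T'.image Int.natAbs, 2 * f i := sum_le_sum hcard
    _ ≤ ∑ i ∈ Finset.Ico N (K + 1), 2 * f i :=
        sum_le_sum_of_subset_of_nonneg himg fun i _ _ => by positivity
    _ = 2 * ∑ i ∈ Finset.Ico N (K + 1), f i := by rw [mul_sum]
    _ ≤ 2 * (1 / (1 + s * ((N : ℝ) - 1))) := by gcongr
    _ ≤ 2 / M := by
        rw [mul_one_div]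
        exact div_le_div_of_nonneg_left (by norm_num) (by linarith) hden

/-! ### The far Riemann bound on `ℤ⁴` -/

/-- A far site has a far coordinate: `D < ‖s x‖ ⇒ ∃ μ, D/2 < s|x_μ|` (`‖u‖ ≤ 2 max_μ |u_μ|` on `ℝ⁴`). [folklore] -/
theorem exists_coord_of_far {s D : ℝ} (hs : 0 ≤ s) (x : Site 4) (hx : D < ‖s • siteToE x‖) :
    ∃ μ : Fin 4, D / 2 < s * |(x μ : ℝ)| := by
  by_contra h
  push Not at h
  have hsq : ‖s • siteToE x‖ ^ 2 ≤ D ^ 2 := by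
    rw [EuclideanSpace.norm_eq, Real.sq_sqrt (sum_nonneg fun _ _ => sq_nonneg _)]
    calc ∑ μ : Fin 4, ‖(s • siteToE x) μ‖ ^ 2 ≤ ∑ _μ : Fin 4, (D / 2) ^ 2 := by
          refine sum_le_sum fun μ _ => ?_
          have hμ : ‖(s • siteToE x) μ‖ = s * |(x μ : ℝ)| := by
            simp [Real.norm_eq_abs, abs_of_nonneg hs]
          rw [hμ]
          exact pow_le_pow_left₀ (by positivity) (h μ) 2
      _ = D ^ 2 := by simp; ring
  have hD : 0 ≤ D := by
    by_contra hD
    push Not at hD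
    have := h 0
    have : 0 ≤ s * |(x 0 : ℝ)| := by positivity
    linarith
  have hle : ‖s • siteToE x‖ ≤ D := (pow_le_pow_iff_left₀ (norm_nonneg _) hD two_ne_zero).mp hsq
  linarith


/-- Pointwise product domination: `s⁴ (1 + ‖s x‖)^{-8} ≤ ∏_μ s/(1 + s|x_μ|)²` (the tree's
`pow_div_one_add_pow_le_prod_weight` with one site). [folklore] -/
theorem pow_four_mul_bracket_le_prod {s : ℝ} (hs : 0 < s) (x : Site 4) :
    s ^ 4 * ((1 + ‖s • siteToE x‖) ^ 8)⁻¹ ≤ ∏ μ : Fin 4, s / (1 + s * |(x μ : ℝ)|) ^ 2 := by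
  have hR : ∀ (i : Fin 1) (μ : Fin 4), s * |((fun _ : Fin 1 => x) i μ : ℝ)| ≤ ‖s • siteToE x‖ := by
    intro i μ
    calc s * |(x μ : ℝ)| = ‖(s • siteToE x) μ‖ := by simp [Real.norm_eq_abs, abs_of_pos hs]
      _ ≤ ‖s • siteToE x‖ := PiLp.norm_apply_le _ μ
  have h := pow_div_one_add_pow_le_prod_weight s hs.le (d := 4) (n := 1) (fun _ : Fin 1 => x) hR
  simp only [Fin.prod_univ_one, Nat.mul_one] at h
  rw [div_eq_mul_inv] at h
  exact h

/-- **One coordinate slab**: `Σ_{x ∈ box L, D/2 < s|x_μ|} ∏_ν s/(1 + s|x_ν|)² ≤ 256/D` for `0 < s ≤ 1`, `2 ≤ D`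
(the slab is a product set; the far factor is `≤ 4/D` by `sum_filter_weight_int_le`, the three others `≤ 4`). [folklore] -/
theorem sum_slab_prod_weight_le {s : ℝ} (hs : 0 < s) (hs1 : s ≤ 1) (L : ℕ) {D : ℝ} (hD : 2 ≤ D) (μ : Fin 4) :
    ∑ x ∈ (box 4 L).filter (fun x : Site 4 => D / 2 < s * |(x μ : ℝ)|),
        ∏ ν : Fin 4, s / (1 + s * |(x ν : ℝ)|) ^ 2 ≤ 256 / D := by
  classical
  set w : ℤ → ℝ := fun j => s / (1 + s * |(j : ℝ)|) ^ 2 with hw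
  have hw0 : ∀ j, 0 ≤ w j := fun j => by positivity
  set T : Finset ℤ := Finset.Icc (-(L : ℤ)) L with hT
  set t : Fin 4 → Finset ℤ :=
    Function.update (fun _ => T) μ (T.filter (fun j : ℤ => D / 2 < s * |(j : ℝ)|)) with ht
  have hslab_eq : (box 4 L).filter (fun x : Site 4 => D / 2 < s * |(x μ : ℝ)|) = Fintype.piFinset t := by
    ext x
    simp only [Finset.mem_filter, Fintype.mem_piFinset, mem_box]
    constructor
    · rintro ⟨hx, hfar⟩ ν
      by_cases hν : ν = μ
      · subst hν
        rw [ht, Function.update_self, Finset.mem_filter, hT, Finset.mem_Icc]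
        exact ⟨hx ν, hfar⟩
      · rw [ht, Function.update_of_ne hν, hT, Finset.mem_Icc]
        exact hx ν
    · intro h
      refine ⟨fun ν => ?_, ?_⟩
      · by_cases hν : ν = μ
        · subst hν
          have h' := h ν
          rw [ht, Function.update_self, Finset.mem_filter, hT, Finset.mem_Icc] at h'
          exact h'.1
        · have h' := h ν
          rw [ht, Function.update_of_ne hν, hT, Finset.mem_Icc] at h'
          exact h'
      · have h' := h μ
        rw [ht, Function.update_self, Finset.mem_filter] at h'
        exact h'.2
  have hsum : ∑ x ∈ Fintype.piFinset t, ∏ ν : Fin 4, w (x ν) = ∏ ν : Fin 4, ∑ j ∈ t ν, w j :=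
    (Finset.prod_univ_sum t (fun _ j => w j)).symm
  change ∑ x ∈ (box 4 L).filter (fun x : Site 4 => D / 2 < s * |(x μ : ℝ)|), ∏ ν : Fin 4, w (x ν) ≤ 256 / D
  rw [hslab_eq, hsum, ← Finset.mul_prod_erase Finset.univ (fun ν => ∑ j ∈ t ν, w j) (Finset.mem_univ μ)]
  have hμ : ∑ j ∈ t μ, w j ≤ 4 / D := by
    have hupd : t μ = T.filter (fun j : ℤ => D / 2 < s * |(j : ℝ)|) := by rw [ht, Function.update_self]
    rw [hupd]
    have h := sum_filter_weight_int_le hs hs1 (M := D / 2) (by linarith) T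
    calc ∑ j ∈ T.filter (fun j : ℤ => D / 2 < s * |(j : ℝ)|), w j
        ≤ ∑ j ∈ T.filter (fun j : ℤ => D / 2 ≤ s * |(j : ℝ)|), w j :=
          Finset.sum_le_sum_of_subset_of_nonneg (fun j hj => by
            rw [Finset.mem_filter] at hj ⊢
            exact ⟨hj.1, le_of_lt hj.2⟩) fun j _ _ => hw0 j
      _ ≤ 2 / (D / 2) := h
      _ = 4 / D := by rw [div_div_eq_mul_div]; ring
  have hothers : ∏ ν ∈ Finset.univ.erase μ, ∑ j ∈ t ν, w j ≤ 4 ^ 3 := by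
    have hcard : (Finset.univ.erase μ).card = 3 := by
      rw [Finset.card_erase_of_mem (Finset.mem_univ μ), Finset.card_univ, Fintype.card_fin]
    calc ∏ ν ∈ Finset.univ.erase μ, ∑ j ∈ t ν, w j ≤ ∏ _ν ∈ Finset.univ.erase μ, (4 : ℝ) := by
          refine Finset.prod_le_prod (fun ν _ => Finset.sum_nonneg fun j _ => hw0 j) fun ν hν => ?_
          have hne : ν ≠ μ := Finset.ne_of_mem_erase hν
          have hupd : t ν = T := by rw [ht, Function.update_of_ne hne]
          rw [hupd]
          calc ∑ j ∈ T, w j ≤ 2 * (s + 1) := sum_weight_int_le s hs.le T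
            _ ≤ 4 := by linarith
      _ = 4 ^ 3 := by rw [Finset.prod_const, hcard]
  calc (∑ j ∈ t μ, w j) * ∏ ν ∈ Finset.univ.erase μ, ∑ j ∈ t ν, w j ≤ (4 / D) * 4 ^ 3 :=
        mul_le_mul hμ hothers (Finset.prod_nonneg fun ν _ => Finset.sum_nonneg fun j _ => hw0 j)
          (by positivity)
    _ = 256 / D := by ring

/-- **Far mesh-uniform Riemann bound** on `ℤ⁴`: `s⁴ · Σ_{x ∈ box L, D < ‖s x‖} (1 + ‖s x‖)^{-8} ≤ 1024/D` for
`0 < s ≤ 1` and `2 ≤ D`, uniformly in the box (cover the far region by the four coordinate slabs). [folklore] -/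
theorem sum_box_far_bracket_le {s : ℝ} (hs : 0 < s) (hs1 : s ≤ 1) (L : ℕ) {D : ℝ} (hD : 2 ≤ D) :
    s ^ 4 * ∑ x ∈ (box 4 L).filter (fun x : Site 4 => D < ‖s • siteToE x‖),
        ((1 + ‖s • siteToE x‖) ^ 8)⁻¹ ≤ 1024 / D := by
  classical
  set w : ℤ → ℝ := fun j => s / (1 + s * |(j : ℝ)|) ^ 2 with hw
  have hw0 : ∀ j, 0 ≤ w j := fun j => by positivity
  set P : Fin 4 → Site 4 → Prop := fun μ x => D / 2 < s * |(x μ : ℝ)| with hP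
  set F := (box 4 L).filter (fun x : Site 4 => D < ‖s • siteToE x‖) with hF
  have hprod0 : ∀ x : Site 4, 0 ≤ ∏ ν : Fin 4, w (x ν) := fun x => Finset.prod_nonneg fun ν _ => hw0 _
  have hind0 : ∀ (x : Site 4) (μ : Fin 4), 0 ≤ (if P μ x then ∏ ν : Fin 4, w (x ν) else 0) := by
    intro x μ
    split_ifs
    · exact hprod0 x
    · exact le_rfl
  calc s ^ 4 * ∑ x ∈ F, ((1 + ‖s • siteToE x‖) ^ 8)⁻¹
      = ∑ x ∈ F, s ^ 4 * ((1 + ‖s • siteToE x‖) ^ 8)⁻¹ := Finset.mul_sum _ _ _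
    _ ≤ ∑ x ∈ F, ∏ ν : Fin 4, w (x ν) := Finset.sum_le_sum fun x _ => pow_four_mul_bracket_le_prod hs x
    _ ≤ ∑ x ∈ F, ∑ μ : Fin 4, (if P μ x then ∏ ν : Fin 4, w (x ν) else 0) := by
        refine Finset.sum_le_sum fun x hx => ?_
        rw [hF, Finset.mem_filter] at hx
        obtain ⟨μ, hμ⟩ := exists_coord_of_far hs.le x hx.2
        calc ∏ ν : Fin 4, w (x ν) = (if P μ x then ∏ ν : Fin 4, w (x ν) else 0) := by rw [if_pos hμ]
          _ ≤ ∑ μ' : Fin 4, (if P μ' x then ∏ ν : Fin 4, w (x ν) else 0) :=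
              Finset.single_le_sum (f := fun μ' => if P μ' x then ∏ ν : Fin 4, w (x ν) else 0)
                (fun μ' _ => hind0 x μ') (Finset.mem_univ μ)
    _ ≤ ∑ x ∈ box 4 L, ∑ μ : Fin 4, (if P μ x then ∏ ν : Fin 4, w (x ν) else 0) :=
        Finset.sum_le_sum_of_subset_of_nonneg (by rw [hF]; exact Finset.filter_subset _ _)
          fun x _ _ => Finset.sum_nonneg fun μ _ => hind0 x μ
    _ = ∑ μ : Fin 4, ∑ x ∈ box 4 L, (if P μ x then ∏ ν : Fin 4, w (x ν) else 0) := Finset.sum_comm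
    _ = ∑ μ : Fin 4, ∑ x ∈ (box 4 L).filter (fun x : Site 4 => D / 2 < s * |(x μ : ℝ)|),
          ∏ ν : Fin 4, w (x ν) := by
        refine Finset.sum_congr rfl fun μ _ => ?_
        rw [Finset.sum_filter]
    _ ≤ ∑ _μ : Fin 4, (256 : ℝ) / D := Finset.sum_le_sum fun μ _ => sum_slab_prod_weight_le hs hs1 L hD μ
    _ = 1024 / D := by
        rw [Finset.sum_const, Finset.card_univ, Fintype.card_fin, nsmul_eq_mul]
        push_cast
        ring

/-! ### Torus geometry on the box -/

/-- For a box coordinate `|x| ≤ L` and any `y`: `|x| − |y| ≤ |valMinAbs ((x − y) mod (2L+1))|` — a cyclic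
representative that wraps around is at least `2L+1−|x−y| ≥ |x|−|y|+1` in size. [folklore] -/
theorem abs_sub_abs_le_abs_valMinAbs (L : ℕ) {x : ℤ} (y : ℤ) (hx : |x| ≤ L) :
    |x| - |y| ≤ |((((x - y : ℤ) : ZMod (2 * L + 1))).valMinAbs : ℤ)| := by
  set v : ℤ := (((x - y : ℤ) : ZMod (2 * L + 1))).valMinAbs with hv
  have hdvd : ((2 * L + 1 : ℕ) : ℤ) ∣ (x - y) - v := by
    rw [← ZMod.intCast_eq_intCast_iff_dvd_sub, hv, ZMod.coe_valMinAbs]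
  obtain ⟨q, hq⟩ := hdvd
  by_cases hq0 : q = 0
  · have hv' : v = x - y := by rw [hq0, mul_zero] at hq; linarith
    rw [hv']
    exact abs_sub_abs_le_abs_sub x y
  · -- the wrap-around case
    have hq1 : 1 ≤ |q| := Int.one_le_abs hq0
    have hbig : ((2 * L + 1 : ℕ) : ℤ) ≤ |(x - y) - v| := by
      rw [hq, abs_mul]
      have hc : |((2 * L + 1 : ℕ) : ℤ)| = ((2 * L + 1 : ℕ) : ℤ) := abs_of_nonneg (by positivity)
      rw [hc]
      nlinarith
    have h1 : |(x - y) - v| ≤ |x - y| + |v| := abs_sub _ _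
    have h2 : |x - y| ≤ |x| + |y| := abs_sub x y
    push_cast at hbig
    linarith

/-- **No wrap-around can bring a far site close to a near one**: for `x ∈ box L` and any site `y`,
`‖x‖ − ‖y‖ ≤ torusDist L x y` (Euclidean norms of the integer representatives). [folklore] -/
theorem norm_sub_norm_le_torusDist (L : ℕ) {x : Site 4} (y : Site 4) (hx : x ∈ box 4 L) :
    ‖siteToE x‖ - ‖siteToE y‖ ≤ torusDist L x y := by
  rw [mem_box] at hx
  set vk : Fin 4 → ℝ := fun k => ((((x k - y k : ℤ) : ZMod (2 * L + 1)).valMinAbs : ℤ) : ℝ) with hvk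
  set ck : Fin 4 → ℝ := fun k => max |(x k : ℝ)| |(y k : ℝ)| with hck
  have hxL : ∀ k, |x k| ≤ (L : ℤ) := fun k => abs_le.mpr ⟨(hx k).1, (hx k).2⟩
  -- coordinatewise: `0 ≤ c_k − |y_k| ≤ |v_k|`
  have hk : ∀ k, 0 ≤ ck k - |(y k : ℝ)| ∧ ck k - |(y k : ℝ)| ≤ |vk k| := by
    intro k
    refine ⟨by simp [hck], ?_⟩
    rcases le_total |(x k : ℝ)| |(y k : ℝ)| with h | h
    · rw [hck]; simp only [max_eq_right h, sub_self]; exact abs_nonneg _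
    · rw [hck]; simp only [max_eq_left h]
      have h' := abs_sub_abs_le_abs_valMinAbs L (y k) (hxL k)
      have h'' : ((|x k| - |y k| : ℤ) : ℝ) ≤ ((|((((x k - y k : ℤ) : ZMod (2 * L + 1))).valMinAbs : ℤ)| : ℤ) : ℝ) := by
        exact_mod_cast h'
      push_cast at h''
      simpa [hvk] using h''
  -- the vectors `C = (c_k)`, `Y = (|y_k|)` of `ℝ⁴`
  set C : EuclideanSpace ℝ (Fin 4) := WithLp.toLp 2 (fun k => ck k) with hC
  set Y : EuclideanSpace ℝ (Fin 4) := WithLp.toLp 2 (fun k => |(y k : ℝ)|) with hY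
  have hCx : ‖siteToE x‖ ≤ ‖C‖ := by
    rw [EuclideanSpace.norm_eq, EuclideanSpace.norm_eq]
    refine Real.sqrt_le_sqrt (Finset.sum_le_sum fun k _ => ?_)
    have h1 : ‖(siteToE x) k‖ = |(x k : ℝ)| := by simp [Real.norm_eq_abs]
    have h2 : ‖C k‖ = ck k := by
      simp only [hC, PiLp.toLp_apply, Real.norm_eq_abs]
      exact abs_of_nonneg (le_trans (abs_nonneg _) (le_max_left _ _))
    rw [h1, h2]
    exact pow_le_pow_left₀ (abs_nonneg _) (le_max_left _ _) 2
  have hYy : ‖Y‖ = ‖siteToE y‖ := by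
    rw [EuclideanSpace.norm_eq, EuclideanSpace.norm_eq]
    congr 1
    refine Finset.sum_congr rfl fun k _ => ?_
    simp [hY, Real.norm_eq_abs]
  have hCY : ‖C - Y‖ ≤ torusDist L x y := by
    rw [EuclideanSpace.norm_eq]
    unfold torusDist
    refine Real.sqrt_le_sqrt (Finset.sum_le_sum fun k _ => ?_)
    have h1 : ‖(C - Y) k‖ = ck k - |(y k : ℝ)| := by
      simp only [PiLp.sub_apply, hC, hY, Real.norm_eq_abs]
      exact abs_of_nonneg (hk k).1
    rw [h1]
    have h2 : (ck k - |(y k : ℝ)|) ^ 2 ≤ |vk k| ^ 2 := pow_le_pow_left₀ (hk k).1 (hk k).2 2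
    rw [sq_abs] at h2
    simpa [hvk] using h2
  calc ‖siteToE x‖ - ‖siteToE y‖ ≤ ‖C‖ - ‖Y‖ := by rw [hYy]; linarith
    _ ≤ ‖C - Y‖ := norm_sub_norm_le C Y
    _ ≤ torusDist L x y := hCY

end Summit.QuantumFields.YangMills.Cruxes.ResponseLocalisation.Far

end
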